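import Summits.CriticalPhenomena.SAWScalingLimit.Theses.SAWReversalUpgrade
import Literature.Barriers.CriticalPhenomena.SupercriticalSAWSpaceFillingReversible

/-!
# `LawReversal` (route SAWReversalUpgrade, item stmt-CriticalPhenomena-18006)

Exact time-reversal symmetry of the critical SAW law in transport form: for every discrete domain
`Ω_δ`, endpoints `u v` and every real function `g` on self-avoiding walks `v → u`,
`∫ g d law(v → u) = ∫ g ∘ reverse d law(u → v)`.

Proof: the critical law `SAW.law` is the fugacity-`x` law `SupercriticalSAW.lawAt x` at
`x = x_c` (`lawAt_criticalFugacity`, definitional), and the fugacity-`x` ensembles are exactly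
reversible at every `x` (`SupercriticalSAW.integral_comp_sawReverse_lawAt`, barrier file
`SupercriticalSAWSpaceFillingReversible`: reversal is a weight-preserving bijection,
`x^{|γ^R|} = x^{|γ|}`); `sawReverse γ` is literally `⟨γ.walk.reverse, γ.isPath.reverse⟩`.
[cite: LawlerSchrammWerner2004SAW, §3.1]
-/

noncomputable section

open MeasureTheory
open Literature.Probability.RandomPlanarGeometry Literature.Probability.RandomPlanarGeometry.SAW
open Literature.Barriers.CriticalPhenomena.SupercriticalSAW

namespace Summit.CriticalPhenomena.SAWScalingLimit.Theorems

/-- **`LawReversal` holds**: for every discrete domain `Ω_δ ⊆ δℤ²`, endpoints `u v` and every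
`g : SAW(Ω_δ; v, u) → ℝ`, `∫ g d law(Ω_δ; v, u) = ∫ (γ ↦ g γ^R) d law(Ω_δ; u, v)` — the critical
SAW law pushed through path reversal is the critical SAW law with the endpoints swapped
(`SupercriticalSAW.integral_comp_sawReverse_lawAt` at `x = x_c`).
[cite: LawlerSchrammWerner2004SAW, §3.1] -/
theorem lawReversal_proof :
    Summit.CriticalPhenomena.SAWScalingLimit.Theses.SAWReversalUpgrade.LawReversal := by
  unfold Summit.CriticalPhenomena.SAWScalingLimit.Theses.SAWReversalUpgrade.LawReversal
  intro Ω δ u v g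
  have h := integral_comp_sawReverse_lawAt criticalFugacity Ω δ u v g
  rw [lawAt_criticalFugacity, lawAt_criticalFugacity] at h
  exact h.symm

end Summit.CriticalPhenomena.SAWScalingLimit.Theorems
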